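import Literature.Geometry.Kaehler.ComplexTorusDivisorClassesPrimitive
import Literature.Geometry.Kaehler.ComplexTorusExoticRankSymmetry
import Literature.Geometry.Kaehler.ComplexTorusPicardNumber
import Literature.Geometry.Kaehler.ComplexTorusIntegralHodgeClassesPolarizationPowers
import Literature.Geometry.Kaehler.ComplexTorusHodgeClassesMaximalPicardNumber
import HarnessLib

/-!
# `D•(X) = B•(X)` for an abelian variety from ONE rank: `dim_ℚ B^{⌊g/2⌋}(X) = ρ(X)` ⟹ every Hodge class is a polynomial in divisor classes

Layer `Literature/Geometry/Kaehler`, namespace `Literature.Geometry.Kaehler.ComplexTorus`; lane `lit-hodgefound`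
(Track 2 foundations library), seat p09, generation 46, row g46-#6. THEOREMS ONLY (0 definitions); no named fact, net debt 0.

The tree decides `D•(X) = H^{2•}_Hodge(X)` (Lange's sufficient condition for the Hodge conjecture on `X`, §7.3.1) on a polarised
complex torus through the PRIMITIVE Hodge classes: `∀ p, Dᵖ = Bᵖ ⟺ ∀ 2 ≤ p ≤ g/2, Bᵖ(X)_prim ⊆ Dᵖ(X)`
(`forall_divisorClasses_eq_hodgeClasses_iff_primitive`, from the Lefschetz decomposition `Bᵖ⁺¹ = Bᵖ⁺¹_prim ⊕ L Bᵖ`, Lange §7.3.2 (3),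
and hard Lefschetz for the upper half, §7.3.2 (1)), and it counts that decomposition: `dim Bᵖ⁺¹ = dim Bᵖ⁺¹_prim + dim Bᵖ`
(`finrank_primitiveHodgeClasses_add`), `dim Bᵖ ≤ dim Bᵖ⁺¹` below the middle (`finrank_hodgeClasses_le_succ`). This file turns the two into a
criterion that reads off ONE number: along the chain `ρ(X) = dim_ℚ B¹(X) ≤ dim_ℚ B²(X) ≤ ⋯ ≤ dim_ℚ B^{⌊g/2⌋}(X)` every step is an equality
iff the primitive Hodge classes of that codimension vanish, so **`dim_ℚ B^{⌊g/2⌋}(X) = ρ(X)` forces `Bᵖ(X)_prim = 0` for all `2 ≤ p ≤ g/2`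
and hence `Dᵖ(X) = Bᵖ(X)` for every `p`** — with no hypothesis on `End(X)`, the Hodge group or the period point. The hypothesis holds
for the Hodge-general polarised abelian variety (Mattuck, Lange Thm. 7.3.1 / Prop. 7.3.3: `dim Bᵖ = 1 = ρ`), where the tree already has the
conclusion from `Hg(X) = Sp`; here it is derived from the rank alone (`dim_ℚ B^{⌊g/2⌋}(X) = 1`, §4).

## What is proved

* §1 `primitiveHodgeClasses_eq_bot_iff_finrank_eq`: **`Bᵖ⁺¹(X)_prim = 0 ⟺ dim_ℚ Bᵖ⁺¹(X) = dim_ℚ Bᵖ(X)`** (`2(p+1) ≤ g`);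
  `divisorClasses_succ_eq_hodgeClasses_of_finrank_eq`: `Dᵖ = Bᵖ`, `dim Bᵖ⁺¹ = dim Bᵖ` ⟹ `Dᵖ⁺¹ = Bᵖ⁺¹`.
* §2 `finrank_hodgeClasses_mono` (`p ≤ q ≤ g/2 ⟹ dim Bᵖ ≤ dim B^q`), `finrank_neronSeveriGroup_le_finrank_hodgeClasses`
  (**`ρ(X) ≤ dim_ℚ Bᵖ(X)`**, `1 ≤ p ≤ g/2`); `1 ≤ dim Bᵖ` (`p ≤ g`) is the tree's `IsAbelianVariety.one_le_finrank_hodgeClasses`.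
* §3 `primitiveHodgeClasses_eq_bot_of_finrank_hodgeClasses_eq` (the sandwich), `forall_primitiveHodgeClasses_eq_bot_iff_finrank_eq`
  (**`(∀ 2 ≤ p ≤ g/2, Bᵖ_prim = 0) ⟺ dim B^{⌊g/2⌋} = dim B¹`**), `divisorClasses_eq_hodgeClasses_of_finrank_hodgeClasses_eq_of_le` (`dim B^{p₀} = dim B¹`
  ⟹ `Dᵖ = Bᵖ` for `p ≤ p₀` and, `IsRiemannForm.divisorClasses_eq_hodgeClasses_of_finrank_hodgeClasses_eq_of_add_le`, for `p ≥ g − p₀`), and the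
  criterion **`forall_divisorClasses_eq_hodgeClasses_of_finrank_hodgeClasses_half_eq`** (`dim_ℚ B^{⌊g/2⌋}(X) = dim_ℚ B¹(X) ⟹ ∀ p, Dᵖ(X) = Bᵖ(X)`) with
  its `IsRiemannForm` / `IsAbelianVariety` forms and the Picard-number forms (`… = ρ(X) = rk NS(X)`, also `≤ ρ(X)`), and the integral-lattice
  form (`rk_ℤ Hdg^{⌊g/2⌋}(X, ℤ) = rk NS(X)`).
* §4 `IsRiemannForm.finrank_hodgeClasses_eq_one_of_half` / `IsAbelianVariety.forall_divisorClasses_eq_hodgeClasses_of_finrank_hodgeClasses_half_eq_one`: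
  **`dim_ℚ B^{⌊g/2⌋}(X) = 1 ⟹ dim_ℚ Bᵖ(X) = 1` for all `p ≤ g` and `D•(X) = B•(X)`** (the conclusion of Mattuck's theorem from the rank alone; with
  the tree's `IsRiemannForm.hodgeClasses_eq_span_wedgePow_of_finrank_eq_one`, `Bᵖ(X) = ℚ·θᵖ`).

## The sources, verbatim (held copies)

* H. Lange, *Abelian Varieties over the Complex Numbers* (Springer 2023; held as `book:lange1992-complex-abelian-varieties`, 2023 numbering),
  §7.3.1 (PDF p. 336: `Dᵖ(X) ⊆ H^{2p}_Hodge(X)`; "if `Dᵖ(X) = H^{2p}_Hodge(X)` the Hodge `(p,p)`-conjecture holds for `X`"; Thm. 7.3.1, Prop. 7.3.3),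
  §7.3.2 (1)–(3) (hard Lefschetz and the Lefschetz decomposition on the Hodge classes), §7.3.3 Exercise (2).
* C. Voisin, *Hodge Theory and Complex Algebraic Geometry I* (CUP 2002), held `book:voisin2002-hodge-theory-complex-algebraic-geometry-i`, §6.2.3
  Rem. 6.27 (PDF p. 126), §7.1.2 (PDF p. 134).
The criterion itself is the elementary consequence of these assembled here; it is not claimed to be printed in this form.

## References

* [cite: Lange2023AbelianVarietiesComplex, §7.3.1 (PDF p. 336), Thm. 7.3.1, Prop. 7.3.3; §7.3.2 (1)–(3); §7.3.3 Exercise (2)]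
* [cite: VoisinHodgeI2002, §6.2.3 Rem. 6.27 (PDF p. 126); §7.1.2 (PDF p. 134)]
-/

noncomputable section

-- `Module ℚ` / `Module ℂ` synthesis on `E [⋀^Fin k]→L[ℝ] ℂ` (as in `ComplexTorusDivisorClassesPrimitive`)
set_option maxSynthPendingDepth 3

open Module Function

namespace Literature.Geometry.Kaehler.ComplexTorus

variable {ι : Type*} [Fintype ι] {E : Type*} [NormedAddCommGroup E] [NormedSpace ℂ E]
  [FiniteDimensional ℂ E] (Φ : (ι → ℝ) ≃L[ℝ] E) {η : E [⋀^Fin 2]→L[ℝ] ℝ} {p p₀ : ℕ}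

/-! ### §1 One step: primitive Hodge classes vanish iff the Hodge rank does not grow -/

/-- **`Bᵖ⁺¹(X)_prim = 0 ⟺ dim_ℚ Bᵖ⁺¹(X) = dim_ℚ Bᵖ(X)`** for `2(p+1) ≤ g`, on a complex torus with a non-degenerate `η ∈ NS(X)`
(`dim Bᵖ⁺¹ = dim Bᵖ⁺¹_prim + dim Bᵖ`, the counted Lefschetz decomposition). [cite: Lange2023AbelianVarietiesComplex, §7.3.2 (3)] [cite: VoisinHodgeI2002, §6.2.3 Rem. 6.27 (PDF p. 126)] -/
theorem primitiveHodgeClasses_eq_bot_iff_finrank_eq (hηNS : IsNSForm Φ η) (hη : ∀ v : E, v ≠ 0 → ∃ w : E, η ![v, w] ≠ 0)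
    (hp : 2 * (p + 1) ≤ finrank ℂ E) :
    primitiveHodgeClasses Φ η (p + 1) = ⊥ ↔ finrank ℚ ↥(hodgeClasses Φ (p + 1)) = finrank ℚ ↥(hodgeClasses Φ p) := by
  haveI : FiniteDimensional ℚ ↥(hodgeClasses Φ (p + 1)) := finiteDimensional_hodgeClassesIn Φ _ _
  haveI : FiniteDimensional ℚ ↥(primitiveHodgeClasses Φ η (p + 1)) :=
    Submodule.finiteDimensional_of_le (primitiveHodgeClasses_le Φ η (p + 1))
  rw [← Submodule.finrank_eq_zero]
  have h := finrank_primitiveHodgeClasses_add Φ hηNS hη hp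
  omega

/-- **`dim_ℚ Bᵖ⁺¹(X)_prim = dim_ℚ Bᵖ⁺¹(X) − dim_ℚ Bᵖ(X)`** (`2(p+1) ≤ g`). [cite: Lange2023AbelianVarietiesComplex, §7.3.2 (3)] -/
theorem finrank_primitiveHodgeClasses_eq_sub (hηNS : IsNSForm Φ η) (hη : ∀ v : E, v ≠ 0 → ∃ w : E, η ![v, w] ≠ 0)
    (hp : 2 * (p + 1) ≤ finrank ℂ E) :
    finrank ℚ ↥(primitiveHodgeClasses Φ η (p + 1)) = finrank ℚ ↥(hodgeClasses Φ (p + 1)) - finrank ℚ ↥(hodgeClasses Φ p) := by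
  have h := finrank_primitiveHodgeClasses_add Φ hηNS hη hp
  omega

/-- **One codimension up from a rank equality**: `Dᵖ = Bᵖ`, `2(p+1) ≤ g` and `dim_ℚ Bᵖ⁺¹ = dim_ℚ Bᵖ` give `Dᵖ⁺¹ = Bᵖ⁺¹`
(there are no primitive Hodge classes of codimension `p + 1`, and `Bᵖ⁺¹ = L Bᵖ = L Dᵖ ⊆ Dᵖ⁺¹`).
[cite: Lange2023AbelianVarietiesComplex, §7.3.2 (3); §7.3.3 Exercise (2)] -/
theorem divisorClasses_succ_eq_hodgeClasses_of_finrank_eq (hηNS : IsNSForm Φ η) (hη : ∀ v : E, v ≠ 0 → ∃ w : E, η ![v, w] ≠ 0)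
    (hp : 2 * (p + 1) ≤ finrank ℂ E) (hD : divisorClasses Φ p = hodgeClasses Φ p)
    (hr : finrank ℚ ↥(hodgeClasses Φ (p + 1)) = finrank ℚ ↥(hodgeClasses Φ p)) :
    divisorClasses Φ (p + 1) = hodgeClasses Φ (p + 1) := by
  refine (divisorClasses_succ_eq_hodgeClasses_iff_primitive Φ hηNS hη hp hD).2 ?_
  rw [(primitiveHodgeClasses_eq_bot_iff_finrank_eq Φ hηNS hη hp).2 hr]
  exact bot_le

/-! ### §2 The rank chain `ρ(X) = dim_ℚ B¹(X) ≤ dim_ℚ B²(X) ≤ ⋯ ≤ dim_ℚ B^{⌊g/2⌋}(X)` -/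

/-- **`dim_ℚ Bᵖ(X) ≤ dim_ℚ B^q(X)` for `p ≤ q ≤ g/2`** (`L^{q−p} : Bᵖ ↪ B^q` below the middle).
[cite: Lange2023AbelianVarietiesComplex, §7.3.2 (1)] [cite: VoisinHodgeI2002, §7.1.2 (PDF p. 134)] -/
theorem finrank_hodgeClasses_mono (hηNS : IsNSForm Φ η) (hη : ∀ v : E, v ≠ 0 → ∃ w : E, η ![v, w] ≠ 0) {p q : ℕ}
    (hpq : p ≤ q) (hq : 2 * q ≤ finrank ℂ E) :
    finrank ℚ ↥(hodgeClasses Φ p) ≤ finrank ℚ ↥(hodgeClasses Φ q) := by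
  obtain ⟨t, rfl⟩ := Nat.exists_eq_add_of_le hpq
  induction t with
  | zero => exact le_rfl
  | succ t ih =>
    exact (ih (by omega) (by omega)).trans (finrank_hodgeClasses_le_succ Φ hηNS hη (p := p + t) (by omega))

/-- **`ρ(X) ≤ dim_ℚ Bᵖ(X)` for `1 ≤ p ≤ g/2`** (`ρ(X) = rk NS(X) = dim_ℚ B¹(X)`, then the chain).
[cite: Lange2023AbelianVarietiesComplex, §7.3.2 (1); §7.3.3 Exercise (2)(a)] -/
theorem finrank_neronSeveriGroup_le_finrank_hodgeClasses (hηNS : IsNSForm Φ η) (hη : ∀ v : E, v ≠ 0 → ∃ w : E, η ![v, w] ≠ 0)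
    (h1 : 1 ≤ p) (hp : 2 * p ≤ finrank ℂ E) :
    finrank ℤ ↥(neronSeveriGroup Φ) ≤ finrank ℚ ↥(hodgeClasses Φ p) := by
  rw [finrank_neronSeveriGroup_eq_finrank_hodgeClasses]
  exact finrank_hodgeClasses_mono Φ hηNS hη h1 hp

/-! ### §3 The criterion -/

/-- **The sandwich**: if `dim_ℚ B^{p₀}(X) = dim_ℚ B¹(X)` with `2p₀ ≤ g`, then `Bᵖ(X)_prim = 0` for every `2 ≤ p ≤ p₀`
(`dim B¹ ≤ dim Bᵖ⁻¹ ≤ dim Bᵖ ≤ dim B^{p₀} = dim B¹`). [cite: Lange2023AbelianVarietiesComplex, §7.3.2 (1), (3)] -/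
theorem primitiveHodgeClasses_eq_bot_of_finrank_hodgeClasses_eq (hηNS : IsNSForm Φ η)
    (hη : ∀ v : E, v ≠ 0 → ∃ w : E, η ![v, w] ≠ 0) (hp₀ : 2 * p₀ ≤ finrank ℂ E)
    (h : finrank ℚ ↥(hodgeClasses Φ p₀) = finrank ℚ ↥(hodgeClasses Φ 1)) (h2 : 2 ≤ p) (hp : p ≤ p₀) :
    primitiveHodgeClasses Φ η p = ⊥ := by
  obtain ⟨p, rfl⟩ : ∃ p', p = p' + 1 := ⟨p - 1, by omega⟩
  refine (primitiveHodgeClasses_eq_bot_iff_finrank_eq Φ hηNS hη (by omega)).2 (le_antisymm ?_ ?_)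
  · calc finrank ℚ ↥(hodgeClasses Φ (p + 1)) ≤ finrank ℚ ↥(hodgeClasses Φ p₀) := finrank_hodgeClasses_mono Φ hηNS hη hp hp₀
      _ = finrank ℚ ↥(hodgeClasses Φ 1) := h
      _ ≤ finrank ℚ ↥(hodgeClasses Φ p) := finrank_hodgeClasses_mono Φ hηNS hη (by omega) (by omega)
  · exact finrank_hodgeClasses_le_succ Φ hηNS hη (by omega)

/-- **`(∀ 2 ≤ p ≤ p₀, Bᵖ(X)_prim = 0) ⟺ dim_ℚ B^{p₀}(X) = dim_ℚ B¹(X)`** for `1 ≤ p₀`, `2p₀ ≤ g`: the rank chain is constant exactly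
when there are no primitive Hodge classes of codimension `2, …, p₀`. [cite: Lange2023AbelianVarietiesComplex, §7.3.2 (1), (3)] -/
theorem forall_primitiveHodgeClasses_eq_bot_iff_finrank_eq (hηNS : IsNSForm Φ η)
    (hη : ∀ v : E, v ≠ 0 → ∃ w : E, η ![v, w] ≠ 0) (h1 : 1 ≤ p₀) (hp₀ : 2 * p₀ ≤ finrank ℂ E) :
    (∀ p, 2 ≤ p → p ≤ p₀ → primitiveHodgeClasses Φ η p = ⊥) ↔
      finrank ℚ ↥(hodgeClasses Φ p₀) = finrank ℚ ↥(hodgeClasses Φ 1) := by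
  refine ⟨fun hP ↦ ?_, fun h p h2 hp ↦ primitiveHodgeClasses_eq_bot_of_finrank_hodgeClasses_eq Φ hηNS hη hp₀ h h2 hp⟩
  -- constant chain by induction on `p ≤ p₀`
  suffices key : ∀ p, 1 ≤ p → p ≤ p₀ → finrank ℚ ↥(hodgeClasses Φ p) = finrank ℚ ↥(hodgeClasses Φ 1) from key p₀ h1 le_rfl
  intro p
  induction p with
  | zero => intro h; omega
  | succ p ih =>
    intro _ hp
    rcases p with _ | p
    · rfl
    · rw [(primitiveHodgeClasses_eq_bot_iff_finrank_eq Φ hηNS hη (by omega)).1 (hP (p + 2) (by omega) hp)]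
      exact ih (by omega) (by omega)

/-- **`dim_ℚ B^{p₀}(X) = dim_ℚ B¹(X)`, `2p₀ ≤ g` ⟹ `Dᵖ(X) = Bᵖ(X)` for all `p ≤ p₀`** (induction on `p`, one step = §1).
[cite: Lange2023AbelianVarietiesComplex, §7.3.2 (3); §7.3.3 Exercise (2)] -/
theorem divisorClasses_eq_hodgeClasses_of_finrank_hodgeClasses_eq_of_le (hηNS : IsNSForm Φ η)
    (hη : ∀ v : E, v ≠ 0 → ∃ w : E, η ![v, w] ≠ 0) (hp₀ : 2 * p₀ ≤ finrank ℂ E)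
    (h : finrank ℚ ↥(hodgeClasses Φ p₀) = finrank ℚ ↥(hodgeClasses Φ 1)) (hp : p ≤ p₀) :
    divisorClasses Φ p = hodgeClasses Φ p := by
  induction p with
  | zero => exact divisorClasses_zero_eq_hodgeClasses Φ
  | succ p ih =>
    rcases p with _ | p
    · exact divisorClasses_one_eq_hodgeClasses Φ
    · refine (divisorClasses_succ_eq_hodgeClasses_iff_primitive Φ hηNS hη (by omega) (ih (by omega))).2 ?_
      rw [primitiveHodgeClasses_eq_bot_of_finrank_hodgeClasses_eq Φ hηNS hη hp₀ h (by omega) hp]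
      exact bot_le

/-- … **and `Dᵖ(X) = Bᵖ(X)` for all `p ≥ g − p₀`** on a polarised torus (hard Lefschetz: `Dᵖ = Bᵖ ⟺ D^{g−p} = B^{g−p}`).
[cite: Lange2023AbelianVarietiesComplex, §7.3.2 (1); §7.3.3 Exercise (2)(b)] -/
theorem IsRiemannForm.divisorClasses_eq_hodgeClasses_of_finrank_hodgeClasses_eq_of_add_le (hη : IsRiemannForm Φ η)
    (hp₀ : 2 * p₀ ≤ finrank ℂ E) (h : finrank ℚ ↥(hodgeClasses Φ p₀) = finrank ℚ ↥(hodgeClasses Φ 1))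
    (hp : finrank ℂ E ≤ p + p₀) : divisorClasses Φ p = hodgeClasses Φ p := by
  by_cases hp' : finrank ℂ E < p
  · rw [divisorClasses_eq_bot_of_finrank_lt Φ hp', hodgeClasses_eq_bot_of_finrank_lt Φ hp']
  exact (hη.divisorClasses_eq_hodgeClasses_iff_of_add_eq Φ (p := finrank ℂ E - p) (q := p) (by omega)).1
    (divisorClasses_eq_hodgeClasses_of_finrank_hodgeClasses_eq_of_le Φ hη.isNSForm (hη.exists_apply_ne_zero Φ) hp₀ h
      (by omega))

/-- **THE RANK CRITERION.** On a complex torus `X` of dimension `g` with a non-degenerate `η ∈ NS(X)`: if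
`dim_ℚ B^{p₀}(X) = dim_ℚ B¹(X)` for the last codimension below the middle (`2p₀ ≤ g ≤ 2p₀ + 1`), then `Dᵖ(X) = H^{2p}_Hodge(X)` for
EVERY `p` — all Hodge classes on `X` are `ℚ`-linear combinations of products of divisor classes (Lange §7.3.1: then the Hodge
`(p,p)`-conjecture holds for `X` in every codimension). [cite: Lange2023AbelianVarietiesComplex, §7.3.1 (PDF p. 336); §7.3.2 (1)–(3); §7.3.3 Exercise (2)] -/
theorem forall_divisorClasses_eq_hodgeClasses_of_finrank_hodgeClasses_eq (hηNS : IsNSForm Φ η)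
    (hη : ∀ v : E, v ≠ 0 → ∃ w : E, η ![v, w] ≠ 0) (hp₀ : 2 * p₀ ≤ finrank ℂ E) (hg : finrank ℂ E ≤ 2 * p₀ + 1)
    (h : finrank ℚ ↥(hodgeClasses Φ p₀) = finrank ℚ ↥(hodgeClasses Φ 1)) (p : ℕ) :
    divisorClasses Φ p = hodgeClasses Φ p :=
  divisorClasses_eq_hodgeClasses_of_forall_two_mul_le Φ hηNS hη
    (fun _ hq ↦ divisorClasses_eq_hodgeClasses_of_finrank_hodgeClasses_eq_of_le Φ hηNS hη hp₀ h (by omega)) p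

/-- **THE RANK CRITERION at `p₀ = ⌊g/2⌋`**: `dim_ℚ B^{⌊g/2⌋}(X) = dim_ℚ B¹(X) ⟹ ∀ p, Dᵖ(X) = Bᵖ(X)`.
[cite: Lange2023AbelianVarietiesComplex, §7.3.1 (PDF p. 336); §7.3.2 (1)–(3); §7.3.3 Exercise (2)] -/
theorem forall_divisorClasses_eq_hodgeClasses_of_finrank_hodgeClasses_half_eq (hηNS : IsNSForm Φ η)
    (hη : ∀ v : E, v ≠ 0 → ∃ w : E, η ![v, w] ≠ 0)
    (h : finrank ℚ ↥(hodgeClasses Φ (finrank ℂ E / 2)) = finrank ℚ ↥(hodgeClasses Φ 1)) (p : ℕ) :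
    divisorClasses Φ p = hodgeClasses Φ p :=
  forall_divisorClasses_eq_hodgeClasses_of_finrank_hodgeClasses_eq Φ hηNS hη (p₀ := finrank ℂ E / 2) (by omega) (by omega) h p

/-- The rank criterion on a polarised complex torus (Riemann form). [cite: Lange2023AbelianVarietiesComplex, §7.3.1 (PDF p. 336); §7.3.2 (1)–(3); §7.3.3 Exercise (2)] -/
theorem IsRiemannForm.forall_divisorClasses_eq_hodgeClasses_of_finrank_hodgeClasses_half_eq (hη : IsRiemannForm Φ η)
    (h : finrank ℚ ↥(hodgeClasses Φ (finrank ℂ E / 2)) = finrank ℚ ↥(hodgeClasses Φ 1)) (p : ℕ) :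
    divisorClasses Φ p = hodgeClasses Φ p :=
  ComplexTorus.forall_divisorClasses_eq_hodgeClasses_of_finrank_hodgeClasses_half_eq Φ hη.isNSForm
    (hη.exists_apply_ne_zero Φ) h p

/-- **The rank criterion with the Picard number: `dim_ℚ B^{⌊g/2⌋}(X) ≤ ρ(X) = rk NS(X) ⟹ ∀ p, Dᵖ(X) = Bᵖ(X)`** (`≤` suffices:
`ρ(X) ≤ dim_ℚ B^{⌊g/2⌋}(X)` always). [cite: Lange2023AbelianVarietiesComplex, §7.3.1 (PDF p. 336); §7.3.2 (1)–(3); §7.3.3 Exercise (2)] -/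
theorem IsRiemannForm.forall_divisorClasses_eq_hodgeClasses_of_finrank_hodgeClasses_half_le_finrank_neronSeveriGroup
    (hη : IsRiemannForm Φ η) (h : finrank ℚ ↥(hodgeClasses Φ (finrank ℂ E / 2)) ≤ finrank ℤ ↥(neronSeveriGroup Φ)) (p : ℕ) :
    divisorClasses Φ p = hodgeClasses Φ p := by
  rcases Nat.lt_or_ge (finrank ℂ E) 2 with h1 | h2
  · exact divisorClasses_eq_hodgeClasses_of_isRiemannForm_of_finrank_le_three Φ (by omega) hη p
  refine hη.forall_divisorClasses_eq_hodgeClasses_of_finrank_hodgeClasses_half_eq Φ (le_antisymm ?_ ?_) p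
  · rwa [finrank_neronSeveriGroup_eq_finrank_hodgeClasses] at h
  · exact finrank_hodgeClasses_mono Φ hη.isNSForm (hη.exists_apply_ne_zero Φ) (by omega) (by omega)

/-- **AN ABELIAN VARIETY WHOSE MIDDLE HODGE RANK IS ITS PICARD NUMBER HAS ALL ITS HODGE CLASSES GENERATED BY DIVISORS**:
`dim_ℚ B^{⌊g/2⌋}(X) ≤ rk NS(X) ⟹ Dᵖ(X) = H^{2p}_Hodge(X)` for every `p` (no polarisation in the statement).
[cite: Lange2023AbelianVarietiesComplex, §7.3.1 (PDF p. 336); §7.3.2 (1)–(3); §7.3.3 Exercise (2)] -/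
theorem IsAbelianVariety.forall_divisorClasses_eq_hodgeClasses_of_finrank_hodgeClasses_half_le_finrank_neronSeveriGroup
    (hX : IsAbelianVariety Φ) (h : finrank ℚ ↥(hodgeClasses Φ (finrank ℂ E / 2)) ≤ finrank ℤ ↥(neronSeveriGroup Φ)) (p : ℕ) :
    divisorClasses Φ p = hodgeClasses Φ p := by
  obtain ⟨η, hη⟩ := hX
  exact hη.forall_divisorClasses_eq_hodgeClasses_of_finrank_hodgeClasses_half_le_finrank_neronSeveriGroup Φ h p

/-- **The same on the integral Hodge lattices: `rk_ℤ Hdg^{⌊g/2⌋}(X, ℤ) ≤ rk NS(X) ⟹ ∀ p, Dᵖ(X) = Bᵖ(X)`**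
(`rk_ℤ Hdgᵖ(X, ℤ) = dim_ℚ Bᵖ(X)`, the tree's `finrank_integralHodgeClassesIn_eq_finrank_hodgeClassesIn`).
[cite: Lange2023AbelianVarietiesComplex, §7.3.1 (PDF p. 336); §7.3.2 (1)–(3); §1.1.3 Cor. 1.1.19] -/
theorem IsAbelianVariety.forall_divisorClasses_eq_hodgeClasses_of_finrank_integralHodgeClassesIn_half_le
    (hX : IsAbelianVariety Φ)
    (h : finrank ℤ ↥(integralHodgeClassesIn Φ (2 * (finrank ℂ E / 2)) (finrank ℂ E / 2)) ≤ finrank ℤ ↥(neronSeveriGroup Φ))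
    (p : ℕ) : divisorClasses Φ p = hodgeClasses Φ p := by
  rw [finrank_integralHodgeClassesIn_eq_finrank_hodgeClassesIn] at h
  exact hX.forall_divisorClasses_eq_hodgeClasses_of_finrank_hodgeClasses_half_le_finrank_neronSeveriGroup Φ h p

/-! ### §4 `dim_ℚ B^{⌊g/2⌋}(X) = 1`: the conclusion of Mattuck's theorem from the rank alone -/

/-- **`dim_ℚ B^{⌊g/2⌋}(X) = 1 ⟹ dim_ℚ Bᵖ(X) = 1` for every `p ≤ g`** on a polarised complex torus (`1 ≤ dim Bᵖ ≤ dim B^{⌊g/2⌋}` below the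
middle, hard Lefschetz above); with the tree's `IsRiemannForm.hodgeClasses_eq_span_wedgePow_of_finrank_eq_one`, `Bᵖ(X) = ℚ·θᵖ`.
[cite: Lange2023AbelianVarietiesComplex, §7.3.1 Thm. 7.3.1, Prop. 7.3.3; §7.3.2 (1)] -/
theorem IsRiemannForm.finrank_hodgeClasses_eq_one_of_half (hη : IsRiemannForm Φ η)
    (h : finrank ℚ ↥(hodgeClasses Φ (finrank ℂ E / 2)) = 1) (hp : p ≤ finrank ℂ E) :
    finrank ℚ ↥(hodgeClasses Φ p) = 1 := by
  wlog hle : 2 * p ≤ finrank ℂ E generalizing p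
  · rw [hη.finrank_hodgeClasses_eq_of_add_eq Φ (p := p) (q := finrank ℂ E - p) (by omega)]
    exact this (by omega) (by omega)
  exact le_antisymm (h ▸ finrank_hodgeClasses_mono Φ hη.isNSForm (hη.exists_apply_ne_zero Φ) (by omega) (by omega))
    (IsAbelianVariety.one_le_finrank_hodgeClasses Φ ⟨η, hη⟩ hp)

/-- **`dim_ℚ B^{⌊g/2⌋}(X) = 1 ⟹ ρ(X) = 1 ∧ ∀ p, Dᵖ(X) = Bᵖ(X)`** on a polarised complex torus.
[cite: Lange2023AbelianVarietiesComplex, §7.3.1 Thm. 7.3.1, Prop. 7.3.3; §7.3.2 (1)–(3)] -/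
theorem IsRiemannForm.finrank_neronSeveriGroup_eq_one_and_forall_divisorClasses_eq_hodgeClasses_of_half (hη : IsRiemannForm Φ η)
    (h : finrank ℚ ↥(hodgeClasses Φ (finrank ℂ E / 2)) = 1) (hg : 1 ≤ finrank ℂ E) :
    finrank ℤ ↥(neronSeveriGroup Φ) = 1 ∧ ∀ p, divisorClasses Φ p = hodgeClasses Φ p := by
  have h1 : finrank ℚ ↥(hodgeClasses Φ 1) = 1 := hη.finrank_hodgeClasses_eq_one_of_half Φ h hg
  refine ⟨by rw [finrank_neronSeveriGroup_eq_finrank_hodgeClasses, h1], ?_⟩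
  exact hη.forall_divisorClasses_eq_hodgeClasses_of_finrank_hodgeClasses_half_eq Φ (h.trans h1.symm)

/-- **An abelian variety with `dim_ℚ B^{⌊g/2⌋}(X) = 1` (e.g. the Hodge-general member of every polarised family, Mattuck) has
`Dᵖ(X) = H^{2p}_Hodge(X)` for every `p`.** [cite: Lange2023AbelianVarietiesComplex, §7.3.1 Thm. 7.3.1, Prop. 7.3.3; §7.3.2 (1)–(3)] -/
theorem IsAbelianVariety.forall_divisorClasses_eq_hodgeClasses_of_finrank_hodgeClasses_half_eq_one (hX : IsAbelianVariety Φ)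
    (h : finrank ℚ ↥(hodgeClasses Φ (finrank ℂ E / 2)) = 1) (p : ℕ) : divisorClasses Φ p = hodgeClasses Φ p := by
  obtain ⟨η, hη⟩ := hX
  rcases Nat.lt_or_ge (finrank ℂ E) 1 with h0 | h1
  · exact divisorClasses_eq_hodgeClasses_of_isRiemannForm_of_finrank_le_three Φ (by omega) hη p
  · exact (hη.finrank_neronSeveriGroup_eq_one_and_forall_divisorClasses_eq_hodgeClasses_of_half Φ h h1).2 p

/-! ### §5 The criterion is sufficient, not necessary: maximal Picard number in dimension `4` -/

/-- **The converse of the rank criterion fails.** A complex torus of dimension `4` with maximal Picard number `ρ(X) = 16 = g²`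
(Lange §7.3.3 Exercise (3): `X ≅ E⁴`, `E` with complex multiplication) has `Dᵖ(X) = Bᵖ(X)` for every `p` (the tree's
`divisorClasses_eq_hodgeClasses_of_finrank_neronSeveriGroup_eq_sq`) although `dim_ℚ B²(X) = C(4,2)² = 36 > 16 = ρ(X)`.
[cite: Lange2023AbelianVarietiesComplex, §7.3.3 Exercise (3)(a),(b) (PDF p. 342)] -/
theorem forall_divisorClasses_eq_hodgeClasses_and_lt_of_finrank_neronSeveriGroup_eq_sixteen (h4 : finrank ℂ E = 4)
    (hρ : finrank ℤ ↥(neronSeveriGroup Φ) = 16) :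
    (∀ p, divisorClasses Φ p = hodgeClasses Φ p) ∧ finrank ℚ ↥(hodgeClasses Φ (finrank ℂ E / 2)) = 36 ∧
      finrank ℤ ↥(neronSeveriGroup Φ) < finrank ℚ ↥(hodgeClasses Φ (finrank ℂ E / 2)) := by
  have hρ' : finrank ℤ ↥(neronSeveriGroup Φ) = (finrank ℂ E) ^ 2 := by rw [hρ, h4]; norm_num
  have h36 : finrank ℚ ↥(hodgeClasses Φ (finrank ℂ E / 2)) = 36 := by
    rw [finrank_hodgeClasses_eq_choose_sq_of_finrank_neronSeveriGroup_eq_sq Φ hρ', h4]; decide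
  exact ⟨divisorClasses_eq_hodgeClasses_of_finrank_neronSeveriGroup_eq_sq Φ hρ', h36, by rw [h36, hρ]; norm_num⟩

/-- … and its **`20 = 36 − 16` dimensions of primitive Hodge classes of codimension `2` are non-zero divisor classes**:
`dim_ℚ B²(X)_prim = 20` and `B²(X)_prim ⊆ D²(X)` (for any non-degenerate `η ∈ NS(X)` defining "primitive").
[cite: Lange2023AbelianVarietiesComplex, §7.3.3 Exercise (3)(a),(b) (PDF p. 342); §7.3.2 (3)] -/
theorem finrank_primitiveHodgeClasses_two_eq_twenty_of_finrank_neronSeveriGroup_eq_sixteen (hηNS : IsNSForm Φ η)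
    (hη : ∀ v : E, v ≠ 0 → ∃ w : E, η ![v, w] ≠ 0) (h4 : finrank ℂ E = 4) (hρ : finrank ℤ ↥(neronSeveriGroup Φ) = 16) :
    finrank ℚ ↥(primitiveHodgeClasses Φ η 2) = 20 ∧ primitiveHodgeClasses Φ η 2 ≠ ⊥ ∧
      primitiveHodgeClasses Φ η 2 ≤ divisorClasses Φ 2 := by
  obtain ⟨hD, h36, -⟩ := forall_divisorClasses_eq_hodgeClasses_and_lt_of_finrank_neronSeveriGroup_eq_sixteen Φ h4 hρ
  rw [h4] at h36
  have h1 : finrank ℚ ↥(hodgeClasses Φ 1) = 16 := by rw [← finrank_neronSeveriGroup_eq_finrank_hodgeClasses, hρ]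
  have h20 : finrank ℚ ↥(primitiveHodgeClasses Φ η 2) = 20 := by
    rw [finrank_primitiveHodgeClasses_eq_sub Φ hηNS hη (p := 1) (by omega), h1]
    exact (congrArg (· - 16) h36).trans rfl
  refine ⟨h20, fun h0 ↦ ?_, (hD 2).symm ▸ primitiveHodgeClasses_le Φ η 2⟩
  rw [h0, finrank_bot] at h20
  exact absurd h20 (by norm_num)

end Literature.Geometry.Kaehler.ComplexTorus

end
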